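import Summits.BirchSwinnertonDyer.BirchSwinnertonDyer.Theorems.ManinLocalTwoThreeTranslationNormalizer
import Summits.BirchSwinnertonDyer.BirchSwinnertonDyer.Theorems.ManinLocalTwoThreeCutLatticesHeckeStable
import Summits.BirchSwinnertonDyer.BirchSwinnertonDyer.Theorems.ManinLocalTwoThreeConwayNortonSameLevelTwist
import Summits.BirchSwinnertonDyer.Rank1Residual.ManinAdditive.NeronConwayR
import HarnessLib

/-!
# The translations `t_{j/4}` (`16 ∣ N`) and `t_{j/8}` (`64 ∣ N`) on `S₂(Γ₀(N))`: single slashes, `q`-expansions, and the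
# Ramanujan endomorphisms `R₄`, `R₈` of imc's `NeronConway` leaves — `aₙ(R₄ f) = (iⁿ + (−i)ⁿ) aₙ(f)`

Summit `BirchSwinnertonDyer`, sub-problem `BirchSwinnertonDyer`, route `ManinLocalTwoThree`; width seat `bsd-line-manin23-p2`
(gen 9), `--supports` the crux C2 `ManinOddAtFour` (stmt-BirchSwinnertonDyer-22967).  Cell `bsd-f2-manin`: imc g18's leaves
`…ManinAdditive.NeronConway` (`quarterTranslateGL`, `ramanujanFour`, rows E-imc-127/128/129) and `…NeronConwayR`
(`eighthTranslateGL`, `ramanujanEight`, `endSaturatedConwayLattice`, E-imc-131/132/133).  E-imc-129's docstring names the one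
risk of those rows: «a normalisation slip between the engines' `R₄` and the typed `ramanujanFour` (scalar `16^{1−k/2}`,
`det^{k−1}` in Mathlib's slash)».  This file SETTLES THE NORMALISATION in the kernel: at weight `2`,
`aₙ(R₄ f) = (iⁿ + (−i)ⁿ)·aₙ(f)` and `aₙ(R₈ f) = (Σ_{u odd} ζ₈^{un})·aₙ(f)` — the engines' `c₄(n)`, `c₈(n)`.

PROVED here (sorry-free), generic in the width `h` (`(h j; 0 h)` normalises `Γ₀(N)` when `h² ∣ N` and every unit of
`ℤ/h` is an involution — `h ∣ 24`):

* `upperTranslate_mul_mul_inv_mem` — `(h j; 0 h)` normalises `Γ₀(N)` (`h² ∣ N`, `∀ a d : ℤ/h, ad = 1 → a = d`);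
* `coe_cuspHeckeOperator_upperTranslate_eq_slash`, `cuspHeckeOperator_upperTranslate_two_apply` (`= f(τ + j/h)`),
  `cuspCoeff_cuspHeckeOperator_upperTranslate_two` (`aₙ ↦ e^{2πi jn/h} aₙ`);
* instances: `cuspCoeff_quarterTranslate_two` (`16 ∣ N`), `cuspCoeff_eighthTranslate_two` (`64 ∣ N`);
* **`cuspCoeff_ramanujanFour_two`** — `aₙ(R₄ f) = (iⁿ + (−i)ⁿ) aₙ(f)` (`16 ∣ N`); `ramanujanFour_mem_integralCuspForms0`;
  **`ramanujanFour_eq_zero_of_two_depleted`** — `R₄ f = 0` for every `2`-depleted `f` (every newform at `4 ∣ N`);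
* **`cuspCoeff_ramanujanEight_two`** — `aₙ(R₈ f) = (Σ_{u ∈ {1,3,5,7}} ζ₈^{un}) aₙ(f)` (`64 ∣ N`), `ζ₈ = e^{2πi/8}`;
  `ramanujanEight_eq_zero_of_two_depleted` (`ζ₈^{4} = −1` kills odd `n`).

Sibling file `ManinLocalTwoThreeEndSaturatedHeckeStable`: `T_p` commutes with `R₄`, `R₈` and preserves imc's `S^{G,R}`.

Elementary `q`-expansion bookkeeping (Atkin–Lehner 1970 §4).  BSD is not proved by this; Manin's conjecture is not proved by this.
-/

set_option autoImplicit false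
set_option linter.dupNamespace false

noncomputable section

open scoped MatrixGroups ModularForm Real
open CongruenceSubgroup Matrix.SpecialLinearGroup UpperHalfPlane Complex Matrix.GeneralLinearGroup
open Literature.NumberTheory.EllipticCurves Literature.NumberTheory.EllipticCurves.ModularForms
open Summit.BirchSwinnertonDyer.Rank1Residual.ManinAdditive
open Summit.BirchSwinnertonDyer.Rank1Residual.ManinAdditive.ConwayCut
open Summit.BirchSwinnertonDyer.Rank1Residual.ManinAdditive.NeronConway
open Summit.BirchSwinnertonDyer.Rank1Residual.ManinAdditive.NeronConwayR

namespace Summit.BirchSwinnertonDyer.BirchSwinnertonDyer.Theorems.ManinLocalTwoThree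

/-! ### Generic upper translations `(h j; 0 h)` -/

/-- For `γ ∈ Γ₀(N)` and `h² ∣ N`, with every unit of `ℤ/h` an involution: `h² ∣ c` and `h ∣ d − a`. -/
theorem dvd_entries_of_mem_Gamma0_sq_dvd {N : ℕ} {h : ℕ} [NeZero h] (hN : h ^ 2 ∣ N)
    (hkey : ∀ a d : ZMod h, a * d = 1 → d - a = 0) {γ : SL(2, ℤ)} (hγ : γ ∈ Gamma0 N) :
    (∃ c₁ : ℤ, γ 1 0 = h * h * c₁) ∧ ∃ e : ℤ, γ 1 1 - γ 0 0 = h * e := by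
  have hdet : γ 0 0 * γ 1 1 - γ 0 1 * γ 1 0 = 1 := by
    have := Matrix.det_fin_two (γ : Matrix (Fin 2) (Fin 2) ℤ)
    rw [γ.det_coe] at this
    linarith
  obtain ⟨c', hc⟩ : (N : ℤ) ∣ γ 1 0 := (ZMod.intCast_zmod_eq_zero_iff_dvd _ N).mp (Gamma0_mem.mp hγ)
  obtain ⟨N₁, hN₁⟩ := hN
  refine ⟨⟨N₁ * c', by rw [hc, hN₁]; push_cast; ring⟩, ?_⟩
  have had : ((γ 0 0 : ℤ) : ZMod h) * ((γ 1 1 : ℤ) : ZMod h) = 1 := by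
    have e : (γ 0 0 : ℤ) * γ 1 1 = 1 + h * (h * N₁ * c' * γ 0 1) := by
      rw [hc, hN₁] at hdet; push_cast at hdet; linear_combination hdet
    have h2 := congrArg (fun z : ℤ ↦ (z : ZMod h)) e
    push_cast at h2
    rw [h2, ZMod.natCast_self, zero_mul, add_zero]
  have h0 : (((γ 1 1 - γ 0 0 : ℤ)) : ZMod h) = 0 := by push_cast; exact hkey _ _ had
  exact (ZMod.intCast_zmod_eq_zero_iff_dvd _ h).mp h0

/-- **`(h j; 0 h)` normalises `Γ₀(N)`** when `h² ∣ N` and every unit of `ℤ/h` is an involution (`h ∣ 24`). -/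
theorem upperTranslate_mul_mul_inv_mem {N : ℕ} {h : ℕ} [NeZero h] (hN : h ^ 2 ∣ N)
    (hkey : ∀ a d : ZMod h, a * d = 1 → d - a = 0) {g : GL (Fin 2) ℚ} (j : ℕ)
    (hg : ((glCast g : GL (Fin 2) ℝ) : Matrix (Fin 2) (Fin 2) ℝ) = !![((h : ℤ) : ℝ), ((j : ℤ) : ℝ); 0, ((h : ℤ) : ℝ)])
    {x : GL (Fin 2) ℝ} (hx : x ∈ (Gamma0 N : Subgroup (GL (Fin 2) ℝ))) :
    glCast g * x * (glCast g)⁻¹ ∈ (Gamma0 N : Subgroup (GL (Fin 2) ℝ)) := by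
  obtain ⟨γ, hγ, rfl⟩ := Subgroup.mem_map.mp hx
  obtain ⟨⟨c₁, hc⟩, e, he⟩ := dvd_entries_of_mem_Gamma0_sq_dvd hN hkey hγ
  obtain ⟨γ', h10, hconj⟩ := exists_mapGL_mul_eq_of_upper hg γ hc he
  rw [hconj, mul_inv_cancel_right]
  refine Subgroup.mem_map_of_mem _ ?_
  rw [Gamma0_mem, h10]
  exact Gamma0_mem.mp hγ

/-- `(h j; 0 h) = diag(h, 1) · diag(1, h) · (1 j/h; 0 1)` in `GL(2, ℝ)` (local copy of the lead's private lemma). -/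
private theorem glCast_eq_tpD_mul_tpG_mul_upperRightHom'' {g : GL (Fin 2) ℚ} (h : ℕ) [NeZero h] (j : ℤ)
    (hg : ((glCast g : GL (Fin 2) ℝ) : Matrix (Fin 2) (Fin 2) ℝ) = !![((h : ℤ) : ℝ), (j : ℝ); 0, ((h : ℤ) : ℝ)]) :
    glCast g = tpD h * tpG h * upperRightHom ((j : ℝ) / h) := by
  have hh : (h : ℝ) ≠ 0 := by exact_mod_cast NeZero.ne h
  ext i j'
  rw [hg]
  simp only [Units.val_mul, Matrix.mul_apply, Fin.sum_univ_two, val_tpD, val_tpG]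
  fin_cases i <;> fin_cases j' <;> simp [upperRightHom_apply, mul_div_cancel₀, hh]

/-- `(f ∣₂ (h j; 0 h))(τ) = f(τ + j/h)` (weight `2`; local copy of the lead's private lemma). -/
private theorem slash_two_upper_apply'' {g : GL (Fin 2) ℚ} (h : ℕ) [NeZero h] (j : ℤ)
    (hg : ((glCast g : GL (Fin 2) ℝ) : Matrix (Fin 2) (Fin 2) ℝ) = !![((h : ℤ) : ℝ), (j : ℝ); 0, ((h : ℤ) : ℝ)])
    (f : ℍ → ℂ) (τ : ℍ) :
    (f ∣[(2 : ℤ)] glCast g) τ = f (((j : ℝ) / h) +ᵥ τ) := by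
  rw [glCast_eq_tpD_mul_tpG_mul_upperRightHom'' h j hg, SlashAction.slash_mul, slash_tpD_mul_tpG h 2 f,
    sub_self, zpow_zero, one_smul, slash_upperRightHom_apply]

variable {N : ℕ} [NeZero N]

/-- **One-term formula**: the double-coset operator of a normalising upper translation `g = (h j; 0 h)` is the single slash
`f ∣[k] g`. -/
theorem coe_cuspHeckeOperator_upperTranslate_eq_slash {h : ℕ} [NeZero h] (hN : h ^ 2 ∣ N)
    (hkey : ∀ a d : ZMod h, a * d = 1 → d - a = 0) {g : GL(2, ℚ)⁺} (j : ℕ)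
    (hg : ((glCast (g : GL (Fin 2) ℚ) : GL (Fin 2) ℝ) : Matrix (Fin 2) (Fin 2) ℝ) =
      !![((h : ℤ) : ℝ), ((j : ℤ) : ℝ); 0, ((h : ℤ) : ℝ)]) {k : ℤ} (f : CuspForm (Gamma0 N) k) :
    (⇑(cuspHeckeOperatorₗ (Gamma0 N) k g f) : ℍ → ℂ) = ⇑f ∣[k] glCast (g : GL (Fin 2) ℚ) := by
  have h1 := coe_cuspHeckeCorrespondence_eq_sum (Gamma0 N) (Gamma0 N) k (g : GL (Fin 2) ℚ)
    (isDoubleCosetDecomp_of_normalises fun x hx ↦ upperTranslate_mul_mul_inv_mem hN hkey j hg hx) f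
  rw [Fintype.sum_unique] at h1
  exact h1

/-- **`([Γ₀(N) (h j; 0 h) Γ₀(N)] f)(τ) = f(τ + j/h)`** at weight `2`. -/
theorem cuspHeckeOperator_upperTranslate_two_apply {h : ℕ} [NeZero h] (hN : h ^ 2 ∣ N)
    (hkey : ∀ a d : ZMod h, a * d = 1 → d - a = 0) {g : GL(2, ℚ)⁺} (j : ℕ)
    (hg : ((glCast (g : GL (Fin 2) ℚ) : GL (Fin 2) ℝ) : Matrix (Fin 2) (Fin 2) ℝ) =
      !![((h : ℤ) : ℝ), ((j : ℤ) : ℝ); 0, ((h : ℤ) : ℝ)]) (f : CuspForm (Gamma0 N) 2) (τ : ℍ) :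
    cuspHeckeOperatorₗ (Gamma0 N) 2 g f τ = f ((((j : ℤ) : ℝ) / h) +ᵥ τ) := by
  have e := congrFun (coe_cuspHeckeOperator_upperTranslate_eq_slash hN hkey j hg f) τ
  rw [slash_two_upper_apply'' h (j : ℤ) hg] at e
  exact e

/-- **`aₙ([(h j; 0 h)] f) = e^{2πi jn/h} aₙ(f)`** at weight `2`. -/
theorem cuspCoeff_cuspHeckeOperator_upperTranslate_two {h : ℕ} [NeZero h] (hN : h ^ 2 ∣ N)
    (hkey : ∀ a d : ZMod h, a * d = 1 → d - a = 0) {g : GL(2, ℚ)⁺} (j : ℕ)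
    (hg : ((glCast (g : GL (Fin 2) ℚ) : GL (Fin 2) ℝ) : Matrix (Fin 2) (Fin 2) ℝ) =
      !![((h : ℤ) : ℝ), ((j : ℤ) : ℝ); 0, ((h : ℤ) : ℝ)]) (f : CuspForm (Gamma0 N) 2) (n : ℕ) :
    cuspCoeff (cuspHeckeOperatorₗ (Gamma0 N) 2 g f) n =
      cexp (2 * π * Complex.I * ((((j : ℤ) : ℝ) / h : ℝ) : ℂ)) ^ n * cuspCoeff f n := by
  have hΓ : (1 : ℝ) ∈ (Gamma0 N : Subgroup (GL (Fin 2) ℝ)).strictPeriods :=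
    strictWidthInfty_Gamma0 N ▸ Subgroup.strictWidthInfty_mem_strictPeriods _
  haveI : Fact (IsCusp OnePoint.infty (Gamma0 N : Subgroup (GL (Fin 2) ℝ))) :=
    ⟨Subgroup.isCusp_of_mem_strictPeriods one_pos hΓ⟩
  have hsum : ∀ τ : ℍ, HasSum (fun m : ℕ ↦ (cexp (2 * π * Complex.I * ((((j : ℤ) : ℝ) / h : ℝ) : ℂ)) ^ m * cuspCoeff f m) •
      Function.Periodic.qParam 1 (τ : ℂ) ^ m) (cuspHeckeOperatorₗ (Gamma0 N) 2 g f τ) := by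
    intro τ
    have e := UpperHalfPlane.hasSum_qExpansion one_pos
      (SlashInvariantFormClass.periodic_comp_ofComplex f hΓ) (ModularFormClass.holo f)
      (ModularFormClass.bdd_at_infty f) (((((j : ℤ) : ℝ) / h : ℝ)) +ᵥ τ)
    rw [cuspHeckeOperator_upperTranslate_two_apply hN hkey j hg]
    convert e using 2 with m
    rw [qParam_vadd, ← Complex.exp_nat_mul, mul_pow, smul_eq_mul, smul_eq_mul, cuspCoeff, ← Complex.exp_nat_mul]
    ring_nf
  rw [cuspCoeff, ← ModularFormClass.qExpansion_coeff_unique one_pos hΓ hsum n]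

/-! ### `t_{j/4}` (`16 ∣ N`) and `R₄` -/

/-- Units of `ℤ/4` are involutions. -/
theorem zmod_four_key : ∀ a d : ZMod 4, a * d = 1 → d - a = 0 := by decide

/-- Units of `ℤ/8` are involutions. -/
theorem zmod_eight_key : ∀ a d : ZMod 8, a * d = 1 → d - a = 0 := by decide

omit [NeZero N] in
/-- The real matrix of `quarterTranslateGL j` is `(4 j; 0 4)`. -/
theorem val_glCast_quarterTranslateGL (j : ℕ) :
    ((glCast (quarterTranslateGL j : GL (Fin 2) ℚ) : GL (Fin 2) ℝ) : Matrix (Fin 2) (Fin 2) ℝ) =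
      !![((4 : ℤ) : ℝ), ((j : ℤ) : ℝ); 0, ((4 : ℤ) : ℝ)] := by
  ext i j'
  fin_cases i <;> fin_cases j' <;> simp [quarterTranslateGL, glCast, Matrix.GeneralLinearGroup.mkOfDetNeZero]

omit [NeZero N] in
/-- The real matrix of `eighthTranslateGL j` is `(8 j; 0 8)`. -/
theorem val_glCast_eighthTranslateGL (j : ℕ) :
    ((glCast (eighthTranslateGL j : GL (Fin 2) ℚ) : GL (Fin 2) ℝ) : Matrix (Fin 2) (Fin 2) ℝ) =
      !![((8 : ℤ) : ℝ), ((j : ℤ) : ℝ); 0, ((8 : ℤ) : ℝ)] := by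
  ext i j'
  fin_cases i <;> fin_cases j' <;> simp [eighthTranslateGL, glCast, Matrix.GeneralLinearGroup.mkOfDetNeZero]

/-- **`aₙ(t_{j/4} f) = e^{2πi jn/4} aₙ(f)`** (`16 ∣ N`, weight `2`; `t_{j/4}` the double-coset operator of
`quarterTranslateGL j`). -/
theorem cuspCoeff_quarterTranslate_two (h16 : 16 ∣ N) (j : ℕ) (f : CuspForm (Gamma0 N) 2) (n : ℕ) :
    cuspCoeff (cuspHeckeOperatorₗ (Gamma0 N) 2 (quarterTranslateGL j) f) n =
      cexp (2 * π * Complex.I * ((((j : ℤ) : ℝ) / (4 : ℕ) : ℝ) : ℂ)) ^ n * cuspCoeff f n :=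
  haveI : NeZero (4 : ℕ) := ⟨by norm_num⟩
  cuspCoeff_cuspHeckeOperator_upperTranslate_two (h := 4) (by simpa using h16) zmod_four_key j
    (val_glCast_quarterTranslateGL j) f n

/-- **`aₙ(t_{j/8} f) = e^{2πi jn/8} aₙ(f)`** (`64 ∣ N`, weight `2`). -/
theorem cuspCoeff_eighthTranslate_two (h64 : 64 ∣ N) (j : ℕ) (f : CuspForm (Gamma0 N) 2) (n : ℕ) :
    cuspCoeff (cuspHeckeOperatorₗ (Gamma0 N) 2 (eighthTranslateGL j) f) n =
      cexp (2 * π * Complex.I * ((((j : ℤ) : ℝ) / (8 : ℕ) : ℝ) : ℂ)) ^ n * cuspCoeff f n :=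
  haveI : NeZero (8 : ℕ) := ⟨by norm_num⟩
  cuspCoeff_cuspHeckeOperator_upperTranslate_two (h := 8) (by simpa using h64) zmod_eight_key j
    (val_glCast_eighthTranslateGL j) f n

/-- `e^{2πi/4} = i`. -/
theorem cexp_two_pi_I_quarter : cexp (2 * π * Complex.I * ((((1 : ℕ) : ℤ) : ℝ) / (4 : ℕ) : ℝ)) = Complex.I := by
  have e : (2 * π * Complex.I * ((((1 : ℕ) : ℤ) : ℝ) / (4 : ℕ) : ℝ) : ℂ) = ((π / 2 : ℝ) : ℂ) * Complex.I := by
    push_cast; ring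
  rw [e, Complex.exp_mul_I, ← Complex.ofReal_cos, ← Complex.ofReal_sin, Real.cos_pi_div_two, Real.sin_pi_div_two]
  simp

/-- `e^{2πi·3/4} = −i`. -/
theorem cexp_two_pi_I_three_quarter : cexp (2 * π * Complex.I * ((((3 : ℕ) : ℤ) : ℝ) / (4 : ℕ) : ℝ)) = -Complex.I := by
  have e : (2 * π * Complex.I * ((((3 : ℕ) : ℤ) : ℝ) / (4 : ℕ) : ℝ) : ℂ) =
      (3 : ℕ) * (2 * π * Complex.I * ((((1 : ℕ) : ℤ) : ℝ) / (4 : ℕ) : ℝ)) := by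
    push_cast; ring
  rw [e, Complex.exp_nat_mul, cexp_two_pi_I_quarter]
  rw [pow_succ, pow_two, Complex.I_mul_I]
  ring

/-- **`aₙ(R₄ f) = (iⁿ + (−i)ⁿ) aₙ(f)`** (`16 ∣ N`, weight `2`): the typed `NeronConway.ramanujanFour` IS the engines' `R₄`
(`c₄(n) = 2, 0, −2, 0` for `n ≡ 0, 1, 2, 3 (mod 4)`). -/
theorem cuspCoeff_ramanujanFour_two (h16 : 16 ∣ N) (f : CuspForm (Gamma0 N) 2) (n : ℕ) :
    cuspCoeff (ramanujanFour N 2 f) n = (Complex.I ^ n + (-Complex.I) ^ n) * cuspCoeff f n := by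
  have hR : ramanujanFour N 2 f = cuspHeckeOperatorₗ (Gamma0 N) 2 (quarterTranslateGL 1) f +
      cuspHeckeOperatorₗ (Gamma0 N) 2 (quarterTranslateGL 3) f := by
    simp only [ramanujanFour, LinearMap.smul_apply, LinearMap.add_apply]
    norm_num
  rw [hR, cuspCoeff_add_gamma0, cuspCoeff_quarterTranslate_two h16, cuspCoeff_quarterTranslate_two h16,
    cexp_two_pi_I_quarter, cexp_two_pi_I_three_quarter]
  ring

/-- `iⁿ + (−i)ⁿ` is an integer (`0` for odd `n`, `±2` for even `n`). -/
theorem exists_int_I_pow_add_neg_I_pow (n : ℕ) : ∃ z : ℤ, (z : ℂ) = Complex.I ^ n + (-Complex.I) ^ n := by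
  rcases Nat.even_or_odd n with ⟨m, rfl⟩ | ⟨m, rfl⟩
  · refine ⟨2 * (-1) ^ m, ?_⟩
    rw [← two_mul, pow_mul, pow_mul, neg_pow_two, Complex.I_sq]
    push_cast
    ring
  · refine ⟨0, ?_⟩
    rw [Odd.neg_pow ⟨m, rfl⟩]
    push_cast
    ring

/-- **`R₄` preserves `S₂(Γ₀(N); ℤ)`** (`16 ∣ N`). -/
theorem ramanujanFour_mem_integralCuspForms0 (h16 : 16 ∣ N) {s : CuspForm (Gamma0 N) 2}
    (hs : s ∈ integralCuspForms0 N 2) : ramanujanFour N 2 s ∈ integralCuspForms0 N 2 := by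
  intro n
  obtain ⟨a, ha⟩ := hs n
  obtain ⟨z, hz⟩ := exists_int_I_pow_add_neg_I_pow n
  exact ⟨z * a, by rw [cuspCoeff_ramanujanFour_two h16, Int.cast_mul, hz, ha]⟩

/-- **`R₄ f = 0` for every `2`-depleted `f`** (`16 ∣ N`): `iⁿ + (−i)ⁿ = 0` for odd `n` and `aₙ(f) = 0` for even `n` — in
particular `R₄` annihilates every newform of level `N`. -/
theorem ramanujanFour_eq_zero_of_two_depleted (h16 : 16 ∣ N) {f : CuspForm (Gamma0 N) 2}
    (hf : ∀ n, 2 ∣ n → cuspCoeff f n = 0) : ramanujanFour N 2 f = 0 := by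
  refine eq_of_forall_cuspCoeff_eq_gamma0 fun n => ?_
  rw [cuspCoeff_ramanujanFour_two h16, show cuspCoeff (0 : CuspForm (Gamma0 N) 2) n = 0 by
    rw [cuspCoeff, CuspForm.coe_zero, qExpansion_zero, map_zero]]
  rcases Nat.even_or_odd n with hn | hn
  · rw [hf n (even_iff_two_dvd.mp hn), mul_zero]
  · rw [Odd.neg_pow hn, add_neg_cancel, zero_mul]

/-! ### `R₈` (`64 ∣ N`) -/

/-- **`aₙ(R₈ f) = (Σ_{u ∈ {1,3,5,7}} ζ₈^{un}) aₙ(f)`** (`64 ∣ N`, weight `2`, `ζ₈ = e^{2πi/8}`): the typed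
`NeronConwayR.ramanujanEight` IS the engines' `R₈`. -/
theorem cuspCoeff_ramanujanEight_two (h64 : 64 ∣ N) (f : CuspForm (Gamma0 N) 2) (n : ℕ) :
    cuspCoeff (ramanujanEight N 2 f) n =
      (cexp (2 * π * Complex.I * ((((1 : ℕ) : ℤ) : ℝ) / (8 : ℕ) : ℝ)) ^ n +
        cexp (2 * π * Complex.I * ((((3 : ℕ) : ℤ) : ℝ) / (8 : ℕ) : ℝ)) ^ n +
        cexp (2 * π * Complex.I * ((((5 : ℕ) : ℤ) : ℝ) / (8 : ℕ) : ℝ)) ^ n +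
        cexp (2 * π * Complex.I * ((((7 : ℕ) : ℤ) : ℝ) / (8 : ℕ) : ℝ)) ^ n) * cuspCoeff f n := by
  have hR : ramanujanEight N 2 f = cuspHeckeOperatorₗ (Gamma0 N) 2 (eighthTranslateGL 1) f +
      cuspHeckeOperatorₗ (Gamma0 N) 2 (eighthTranslateGL 3) f + cuspHeckeOperatorₗ (Gamma0 N) 2 (eighthTranslateGL 5) f +
      cuspHeckeOperatorₗ (Gamma0 N) 2 (eighthTranslateGL 7) f := by
    simp only [ramanujanEight, LinearMap.smul_apply, LinearMap.add_apply]
    norm_num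
  rw [hR, cuspCoeff_add_gamma0, cuspCoeff_add_gamma0, cuspCoeff_add_gamma0, cuspCoeff_eighthTranslate_two h64,
    cuspCoeff_eighthTranslate_two h64, cuspCoeff_eighthTranslate_two h64, cuspCoeff_eighthTranslate_two h64]
  ring

/-- `ζ₈^{u} = ζ₈^{u}` bookkeeping: `e^{2πi u/8} = (e^{2πi/8})^u`. -/
theorem cexp_two_pi_I_eighth_nat (u : ℕ) :
    cexp (2 * π * Complex.I * ((((u : ℕ) : ℤ) : ℝ) / (8 : ℕ) : ℝ)) =
      cexp (2 * π * Complex.I * ((((1 : ℕ) : ℤ) : ℝ) / (8 : ℕ) : ℝ)) ^ u := by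
  rw [← Complex.exp_nat_mul]
  congr 1
  push_cast
  ring

/-- `ζ₈⁴ = −1`. -/
theorem cexp_two_pi_I_eighth_pow_four : cexp (2 * π * Complex.I * ((((1 : ℕ) : ℤ) : ℝ) / (8 : ℕ) : ℝ)) ^ 4 = -1 := by
  rw [← Complex.exp_nat_mul, show ((4 : ℕ) : ℂ) * (2 * π * Complex.I * ((((1 : ℕ) : ℤ) : ℝ) / (8 : ℕ) : ℝ)) =
    π * Complex.I by push_cast; ring, Complex.exp_pi_mul_I]

/-- **`R₈ f = 0` for every `2`-depleted `f`** (`64 ∣ N`): for odd `n`, `ζ₈^{5n} = −ζ₈^{n}` and `ζ₈^{7n} = −ζ₈^{3n}`. -/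
theorem ramanujanEight_eq_zero_of_two_depleted (h64 : 64 ∣ N) {f : CuspForm (Gamma0 N) 2}
    (hf : ∀ n, 2 ∣ n → cuspCoeff f n = 0) : ramanujanEight N 2 f = 0 := by
  refine eq_of_forall_cuspCoeff_eq_gamma0 fun n => ?_
  rw [cuspCoeff_ramanujanEight_two h64, show cuspCoeff (0 : CuspForm (Gamma0 N) 2) n = 0 by
    rw [cuspCoeff, CuspForm.coe_zero, qExpansion_zero, map_zero]]
  rcases Nat.even_or_odd n with hn | ⟨m, rfl⟩
  · rw [hf n (even_iff_two_dvd.mp hn), mul_zero]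
  · set ζ := cexp (2 * π * Complex.I * ((((1 : ℕ) : ℤ) : ℝ) / (8 : ℕ) : ℝ)) with hζ
    have h4 : ζ ^ 4 = -1 := cexp_two_pi_I_eighth_pow_four
    rw [cexp_two_pi_I_eighth_nat 3, cexp_two_pi_I_eighth_nat 5, cexp_two_pi_I_eighth_nat 7, ← hζ]
    have e5 : (ζ ^ 5) ^ (2 * m + 1) = -(ζ ^ (2 * m + 1)) := by
      rw [← pow_mul, show 5 * (2 * m + 1) = 4 * (2 * m + 1) + (2 * m + 1) by ring, pow_add, pow_mul, h4,
        Odd.neg_one_pow ⟨m, rfl⟩]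
      ring
    have e7 : (ζ ^ 7) ^ (2 * m + 1) = -((ζ ^ 3) ^ (2 * m + 1)) := by
      rw [← pow_mul, ← pow_mul, show 7 * (2 * m + 1) = 4 * (2 * m + 1) + 3 * (2 * m + 1) by ring, pow_add, pow_mul,
        h4, Odd.neg_one_pow ⟨m, rfl⟩]
      ring
    rw [e5, e7]
    ring

end Summit.BirchSwinnertonDyer.BirchSwinnertonDyer.Theorems.ManinLocalTwoThree

end
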